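import Mathlib.Analysis.Analytic.IsolatedZeros
import Mathlib.Analysis.Calculus.FDeriv.Analytic
import Summits.KontsevichZagierPeriods.KontsevichZagierPeriods.Theorems.ValuedFieldSpecialisationDefs
import Summits.KontsevichZagierPeriods.KontsevichZagierPeriods.Theorems.ValuedFieldSpecialisationClassLevelExpansionFibreDimOneToolkit

/-!
# Route ValuedFieldSpecialisation — tools for the fibre-dimension-zero expansion

Helper for item stmt-KontsevichZagierPeriods-3503 (`ClassLevelExpansionFibreDimOne`): lemmas used
by the fibre-dimension-ZERO case of the class-level expansion (families `R : IntegralRep (0 + 1)`,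
i.e. one-variable `ℚ`-semialgebraic integrands read over the parameter `s = z 0`), which is the
shape to which coefficient functions and integrated-out pieces of one-dimensional families reduce.

* `of_slabRestrict_mem_expandable` — slab restrictions of expandable families are expandable;
* `of_sub_sub_sum_mem_fibredRelations` — `n`-ary integrand additivity inside `fibredRelations`;
* `taylor_split` — `h t = Σ_{n<K} aₙ tⁿ + t^K · G_K t` for `h` with a power series at `0`,
  `G_K = (swap dslope 0)^[K] h` (again analytic), and `isAlgebraic_coeff` — the coefficients
  `aₙ = h⁽ⁿ⁾(0)/n!` are algebraic when the derivatives are (`HasFPowerSeriesOnBall.factorial_smul`);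
* `isDominatedFamily_of_bounded_tendsto` — a one-parameter family with `0`-dimensional fibres
  (a function of `s` alone) which is bounded near `0⁺` by a rational constant and tends to an
  algebraic limit is a dominated family.

Sources: M. Kontsevich, D. Zagier, *Periods* (2001), §1.2; the fibred calculus is this route's.
Deliberately NOT here: the Puiseux theorem (taken from
`Theorems/SymplecticScissorsRealOnePeriodRelationsStubPuiseuxGerm.lean`) and the expansion itself
(companion file).
-/

noncomputable section

namespace Summit.KontsevichZagierPeriods.ValuedFieldSpecialisation

open MeasureTheory Set Filter
open scoped Topology
open Literature.NumberTheory.Transcendental Literature.NumberTheory.Transcendental.KZ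
open Literature.ModelTheory.ExponentialFields (IsSemialgebraic)

variable {n : ℕ}

/-! ### Expandability bookkeeping -/

/-- **Reduction to a slab**: a family is expandable as soon as its restriction to
`{0 < z 0 < ε}` is, for some rational `ε > 0` (the complement is dominated, the cut is a fibred
move). [folklore] -/
theorem of_mem_expandable_of_slabRestrict (R : IntegralRep (n + 1)) {ε : ℚ} (hε : 0 < ε)
    (h : of (R.slabRestrict 0 ε) ∈ expandable) : of R ∈ expandable := by
  have h1 := mem_expandable_of_mem_fibredRelations (of_sub_of_slabRestrict_sub_mem_fibredRelations R ε)
  have h2 := of_mem_expandable_of_isDominatedFamily (isDominatedFamily_slabCompl R hε)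
  have : of R = (of R - of (R.slabRestrict 0 ε) - of (R.slabCompl 0 ε)) +
      of (R.slabRestrict 0 ε) + of (R.slabCompl 0 ε) := by abel
  rw [this]
  exact expandable.add_mem (expandable.add_mem h1 h) h2

/-- **Splitting**: if `σ = A ∪ B` (semialgebraic pieces, null overlap) and both restrictions are
expandable then so is `[σ, f]`. [folklore] -/
theorem of_mem_expandable_of_split {d : ℕ} (R : IntegralRep d) {A B : Set (Fin d → ℝ)}
    (hA : IsSemialgebraic ℚ A) (hB : IsSemialgebraic ℚ B) (hAB : R.domain = A ∪ B)
    (hnull : volume (A ∩ B) = 0)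
    (h₁ : of (R.restrict A hA (hAB ▸ subset_union_left)) ∈ expandable)
    (h₂ : of (R.restrict B hB (hAB ▸ subset_union_right)) ∈ expandable) : of R ∈ expandable := by
  have h0 := mem_expandable_of_mem_fibredRelations
    (of_sub_of_restrict_sub_of_restrict_mem_fibredRelations R hA hB hAB hnull)
  have : of R = (of R - of (R.restrict A hA (hAB ▸ subset_union_left)) -
      of (R.restrict B hB (hAB ▸ subset_union_right))) +
      of (R.restrict A hA (hAB ▸ subset_union_left)) +
      of (R.restrict B hB (hAB ▸ subset_union_right)) := by abel
  rw [this]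
  exact expandable.add_mem (expandable.add_mem h0 h₁) h₂

/-- **Slab restrictions of expandable families are expandable** (`0 < ε` rational): the cut at
`s = ε` is a fibred move and the complement of the slab is dominated. [folklore] -/
theorem of_slabRestrict_mem_expandable (R : IntegralRep (n + 1)) {ε : ℚ} (hε : 0 < ε)
    (h : of R ∈ expandable) : of (R.slabRestrict 0 ε) ∈ expandable := by
  have h1 := mem_expandable_of_mem_fibredRelations (of_sub_of_slabRestrict_sub_mem_fibredRelations R ε)
  have h2 := of_mem_expandable_of_isDominatedFamily (isDominatedFamily_slabCompl R hε)
  have : of (R.slabRestrict 0 ε) =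
      of R - (of R - of (R.slabRestrict 0 ε) - of (R.slabCompl 0 ε)) - of (R.slabCompl 0 ε) := by
    abel
  rw [this]
  exact expandable.sub_mem (expandable.sub_mem h h1) h2

/-- Finite sums of `ℚ`-semialgebraic functions are `ℚ`-semialgebraic. [BCR 1998, Prop. 2.2.6]
[folklore] -/
theorem isSemialgebraicFunOn_fin_sum {k : ℕ} {σ : Set (Fin n → ℝ)} (hσ : IsSemialgebraic ℚ σ)
    (F : Fin k → (Fin n → ℝ) → ℝ) (hF : ∀ i, IsSemialgebraicFunOn ℚ σ (F i)) :
    IsSemialgebraicFunOn ℚ σ (fun x => ∑ i, F i x) := by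
  induction k with
  | zero => simpa using isSemialgebraicFunOn_ratCast hσ 0
  | succ k ih =>
    have h := IsSemialgebraicFunOn.add_holds (ih (fun i => F (Fin.castSucc i)) fun i => hF _)
      (hF (Fin.last k))
    exact h.congr fun x _ => by simp [Fin.sum_univ_castSucc]

/-- **`n`-ary integrand additivity is a fibred relation**: if `R`, `R₀`, `R₁, …, R_k` have the same
domain and `R.integrand = R₀.integrand + Σ Rᵢ.integrand` on it, then
`[R] − [R₀] − Σ [Rᵢ] ∈ fibredRelations` (induction on `k` through the partial sums, which are
again representations). [Kontsevich–Zagier 2001, §1.2, rule (1)] [folklore] -/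
theorem of_sub_sub_sum_mem_fibredRelations {N : ℕ} :
    ∀ (k : ℕ) (R R₀ : IntegralRep N) (Rs : Fin k → IntegralRep N), R₀.domain = R.domain →
      (∀ i, (Rs i).domain = R.domain) →
      EqOn R.integrand (fun x => R₀.integrand x + ∑ i, (Rs i).integrand x) R.domain →
      of R - of R₀ - ∑ i, of (Rs i) ∈ fibredRelations
  | 0, R, R₀, Rs, hd₀, _, h => by
    simp only [Finset.univ_eq_empty, Finset.sum_empty, sub_zero, add_zero] at h ⊢
    exact of_sub_of_mem_fibredRelations_of_eqOn hd₀ h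
  | k + 1, R, R₀, Rs, hd₀, hd, h => by
    let R' : IntegralRep N :=
      { domain := R.domain
        integrand := fun x => R₀.integrand x + ∑ i : Fin k, (Rs (Fin.castSucc i)).integrand x
        isSemialgebraic_domain := R.isSemialgebraic_domain
        isSemialgebraicFunOn_integrand :=
          IsSemialgebraicFunOn.add_holds (hd₀ ▸ R₀.isSemialgebraicFunOn_integrand)
            (isSemialgebraicFunOn_fin_sum R.isSemialgebraic_domain _ fun i =>
              hd (Fin.castSucc i) ▸ (Rs (Fin.castSucc i)).isSemialgebraicFunOn_integrand)
        integrableOn := (hd₀ ▸ R₀.integrableOn).add (integrable_finsetSum _ fun i _ =>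
          hd (Fin.castSucc i) ▸ (Rs (Fin.castSucc i)).integrableOn) }
    have h1 : of R - of R' - of (Rs (Fin.last k)) ∈ fibredRelations :=
      mem_fibredRelations_of_mem_integrandAddRel ⟨N, R, R', Rs (Fin.last k), rfl, hd _, fun x hx => by
        show R.integrand x = R'.integrand x + (Rs (Fin.last k)).integrand x
        rw [h hx]
        simp only [R', Fin.sum_univ_castSucc]
        ring, rfl⟩
    have h2 : of R' - of R₀ - ∑ i : Fin k, of (Rs (Fin.castSucc i)) ∈ fibredRelations :=
      of_sub_sub_sum_mem_fibredRelations k R' R₀ (fun i => Rs (Fin.castSucc i)) hd₀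
        (fun i => hd (Fin.castSucc i)) fun x _ => rfl
    rw [Fin.sum_univ_castSucc]
    have : of R - of R₀ - (∑ i : Fin k, of (Rs (Fin.castSucc i)) + of (Rs (Fin.last k))) =
        (of R - of R' - of (Rs (Fin.last k))) +
          (of R' - of R₀ - ∑ i : Fin k, of (Rs (Fin.castSucc i))) := by abel
    rw [this]
    exact fibredRelations.add_mem h1 h2

/-! ### Taylor splitting of a real-analytic germ -/

/-- **Taylor splitting**: if `h` has the power series `p` at `0` then for every `K` and every `t`,
`h t = Σ_{n<K} (p.coeff n) tⁿ + t^K · ((swap dslope 0)^[K] h) t` (induction on `K` with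
`(t − 0) • dslope g 0 t = g t − g 0` and `g 0 = ` the constant coefficient of its series).
[folklore] -/
theorem taylor_split {h : ℝ → ℝ} {p : FormalMultilinearSeries ℝ ℝ ℝ} (hp : HasFPowerSeriesAt h p 0) :
    ∀ (K : ℕ) (t : ℝ), h t = (∑ n ∈ Finset.range K, p.coeff n * t ^ n) +
      t ^ K * (Function.swap dslope 0)^[K] h t
  | 0, t => by simp
  | K + 1, t => by
    have ih := taylor_split hp K t
    set G : ℝ → ℝ := (Function.swap dslope 0)^[K] h with hG
    have hGp : HasFPowerSeriesAt G (FormalMultilinearSeries.fslope^[K] p) 0 :=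
      hp.has_fpower_series_iterate_dslope_fslope K
    have hG0 : G 0 = p.coeff K := by
      have h2 : (FormalMultilinearSeries.fslope^[K] p).coeff 0 = G 0 := hGp.coeff_zero (fun _ => 1)
      rw [FormalMultilinearSeries.coeff_iterate_fslope, zero_add] at h2
      exact h2.symm
    have hds : G t = G 0 + t * dslope G 0 t := by
      have := sub_smul_dslope G 0 t
      rw [sub_zero, smul_eq_mul] at this
      linarith
    rw [Function.iterate_succ_apply', Finset.sum_range_succ, ih]
    change _ + t ^ K * G t = _ + t ^ (K + 1) * dslope G 0 t
    rw [hds, hG0]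
    ring

/-- The split remainder `(swap dslope 0)^[K] h` is analytic at `0`, with constant coefficient
`p.coeff K`. [folklore] -/
theorem analyticAt_iterate_dslope {h : ℝ → ℝ} {p : FormalMultilinearSeries ℝ ℝ ℝ}
    (hp : HasFPowerSeriesAt h p 0) (K : ℕ) :
    AnalyticAt ℝ ((Function.swap dslope 0)^[K] h) 0 ∧ (Function.swap dslope 0)^[K] h 0 = p.coeff K := by
  have hGp := hp.has_fpower_series_iterate_dslope_fslope K
  refine ⟨hGp.analyticAt, ?_⟩
  have h2 : (FormalMultilinearSeries.fslope^[K] p).coeff 0 = (Function.swap dslope 0)^[K] h 0 :=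
    hGp.coeff_zero (fun _ => 1)
  rw [FormalMultilinearSeries.coeff_iterate_fslope, zero_add] at h2
  exact h2.symm

/-- **The Taylor coefficients are `h⁽ⁿ⁾(0)/n!`**, hence algebraic when the derivatives are.
[folklore] -/
theorem isAlgebraic_coeff {h : ℝ → ℝ} {p : FormalMultilinearSeries ℝ ℝ ℝ}
    (hp : HasFPowerSeriesAt h p 0) (halg : ∀ n, IsAlgebraic ℚ (iteratedDeriv n h 0)) (n : ℕ) :
    IsAlgebraic ℚ (p.coeff n) := by
  obtain ⟨r, hr⟩ := hp
  have h1 := hr.factorial_smul (1 : ℝ) n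
  -- `n! • p n (fun _ => 1) = iteratedFDeriv ℝ n h 0 (fun _ => 1) = iteratedDeriv n h 0`
  rw [← iteratedDeriv_eq_iteratedFDeriv, nsmul_eq_mul] at h1
  have hcoeff : p.coeff n = (n.factorial : ℝ)⁻¹ * iteratedDeriv n h 0 := by
    rw [← h1, ← mul_assoc, inv_mul_cancel₀ (by exact_mod_cast n.factorial_ne_zero), one_mul]
    rfl
  rw [hcoeff]
  exact IsAlgebraic.mul (IsAlgebraic.inv (isAlgebraic_nat _)) (halg n)

/-! ### Bounded convergent one-parameter families with point fibres are dominated -/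

/-- The constant representation of dimension `0` with (algebraic) value `c`: domain the point,
integrand `c`. [Kontsevich–Zagier 2001, §1.1] [folklore] -/
theorem exists_constRep {c : ℝ} (hc : IsAlgebraic ℚ c) :
    ∃ r : IntegralRep 0, r.domain = univ ∧ r.integrand = fun _ => c :=
  ⟨⟨univ, fun _ => c, Literature.ModelTheory.ExponentialFields.isSemialgebraic_univ,
    isSemialgebraicFunOn_const_of_isAlgebraic
      Literature.ModelTheory.ExponentialFields.isSemialgebraic_univ hc,
    by
      rw [IntegrableOn, Measure.restrict_univ]
      exact integrable_const c⟩, rfl, rfl⟩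

/-- **Bounded convergent families with point fibres are dominated.** Let `S : IntegralRep (0 + 1)`
(a function of the parameter alone) satisfy: every `z ∈ S.domain` with `0 < z 0 < ε` has
`|S.integrand z| ≤ C` (`C` rational), `(0, ε) ⊆ S.domain` in the sense that `vecCons s x ∈ S.domain`
for `0 < s < ε`, and `s ↦ S.integrand (vecCons s x)` tends to an algebraic `L` as `s → 0⁺` (for
the unique `x : Fin 0 → ℝ`). Then `S` is dominated by the constant `C` with special fibre the
constant `L`. [folklore] -/
theorem isDominatedFamily_of_bounded_tendsto (S : IntegralRep (0 + 1)) {ε : ℝ} (hε : 0 < ε)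
    {C : ℚ} {L : ℝ} (hL : IsAlgebraic ℚ L)
    (hbound : ∀ z ∈ S.domain, 0 < z 0 → z 0 < ε → |S.integrand z| ≤ C)
    (hmem : ∀ (x : Fin 0 → ℝ) (s : ℝ), 0 < s → s < ε → Matrix.vecCons s x ∈ S.domain)
    (hlim : ∀ x : Fin 0 → ℝ, Tendsto (fun s : ℝ => S.integrand (Matrix.vecCons s x))
      (𝓝[>] 0) (𝓝 L)) :
    ∃ r₀ g : IntegralRep 0, IsDominatedFamily S r₀ g := by
  obtain ⟨r₀, hr₀d, hr₀i⟩ := exists_constRep hL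
  obtain ⟨g, hgd, hgi⟩ := exists_constRep (isAlgebraic_algebraMap (C : ℚ) : IsAlgebraic ℚ ((C : ℚ) : ℝ))
  refine ⟨r₀, g, ⟨ε, hε, fun z hz h0 hzε => ⟨by simp [hgd], ?_⟩⟩, ?_, ?_⟩
  · simpa [hgi] using hbound z hz h0 hzε
  · refine Eventually.of_forall fun x => ?_
    filter_upwards [Ioo_mem_nhdsGT hε] with s hs
    simp only [hr₀d, mem_univ, iff_true]
    exact hmem x s hs.1 hs.2
  · refine Eventually.of_forall fun x _ => ?_
    simpa [hr₀i] using hlim x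

end Summit.KontsevichZagierPeriods.ValuedFieldSpecialisation
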